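import Summits.QuantumFields.QCD.Theorems.QuarksAsStableActionStableActionBridgeFermionSliceOpCovariance
import Summits.QuantumFields.QCD.Theorems.QuarksAsStableActionStableActionBridgeFermionSliceCovariance
import Summits.QuantumFields.QCD.Theorems.QuarksAsStableActionStableActionBridgeSliceGaugeUnitarity
import Summits.QuantumFields.QCD.Theorems.QuarksAsStableActionStableActionBridgeCoreGaugeStep
import Literature.MathematicalPhysics.QuantumFieldTheory.WilsonTorusTransferMatrix

/-!
# Stub `stub_rayleigh_of_invariant` of line `twisted_trace_transfer`
# for crux `QuarksAsStableAction.StableActionBridge` (item stmt-QuantumFields-9737)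

This file proves the registered stub `stub_rayleigh_of_invariant` (sub-goal B4 of step E3 of the
lead skeleton of line `twisted_trace_transfer`): **on gauge-invariant waves the scalarised transfer
form IS Lüscher's transfer form.**

Step E3 realises Lüscher's QCD transfer matrix `T̂ = T̂_F^{1/2} T̂_U T̂_F^{1/2} P̂₀` (Smit,
*Introduction to Quantum Fields on a Lattice*, §6.5 (6.87); Lüscher, CMP 54 (1977)) as the `L²`
integral operator on scalarised Fock-valued waves with the Hermitian kernel
`k((U,s),(U',s')) = (R(U) B(U,U') R(U'))_{s s'}`, where `R(U)` is a pointwise Hermitian square root of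
Smit's fermionic transfer operator `T̂_F(U) = fermionSliceOp U mq` and
`B(U,U') = ∫ K_β(U, U'^g) Γ(G_g) dg` is the Gauss-averaged Wilson gauge kernel
(`K_β = gaugeSliceKernel β`, `Γ(G_g) = fockGaugeAct g`, product Haar over the temporal links
`g : sites → SU(3)`).  The stub links this operator to the tree's min–max levels: for ANY continuous
pointwise Hermitian square root `R` of `T̂_F` and every continuous GAUGE-INVARIANT wave `Ψ`
(`Ψ(U^g) = Γ(G_g) Ψ(U)`, i.e. `Ψ ∈ transferCore`),

1. the quadratic form of `k` at the vector `(U,s) ↦ (R(U)Ψ(U))_s` equals `transferForm β mq Ψ Ψ`;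
2. its `L²`-norm squared `∫ Σ_s ‖(R(U)Ψ(U))_s‖² dU` equals `fermionWeightForm mq Ψ Ψ`.

## Proof

* Pointwise matrix algebra (`StubRayleighOfInvariant.sum_sum_eq_dotProduct`,
  `StubRayleighOfInvariant.dotProduct_sandwich`): with `R(U)ᴴ = R(U)` and `R(U)² = T̂_F(U)`,
  `Σ_s Σ_s' conj((RΨ)(U)_s) (R(U) B R(U'))_{s s'} (RΨ)(U')_{s'} = ⟨T̂_F(U)Ψ(U), B(U,U') T̂_F(U')Ψ(U')⟩`
  (`Matrix.star_mulVec`, `Matrix.dotProduct_mulVec`, `Matrix.mulVec_mulVec`), and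
  `Σ_s ‖(RΨ)(U)_s‖² = ⟨Ψ(U), T̂_F(U)Ψ(U)⟩` (`StubRayleighOfInvariant.sum_norm_sq_eq`), which gives 2.
* The finite sums defining `⟨χ(U), B(U,U') χ(U')⟩` are pulled into the `g`-integral
  (`StubRayleighOfInvariant.dotProduct_kernelMatrix_mulVec`; the integrands
  `g ↦ K_β(U, U'^g) Γ(G_g)_{a c}` are continuous on the compact group of temporal links, hence
  integrable): `⟨χ(U), B χ(U')⟩ = ∫ K_β(U, U'^g) ⟨χ(U), Γ(G_g) χ(U')⟩ dg`, `χ := T̂_F Ψ`.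
* Gauge covariance `T̂_F(U'^g) = Γ(G_g) T̂_F(U') Γ(G_g)ᴴ`
  (`Sketch.fermionSliceOp_gaugeTransform_of` fed with `Sketch.fermionSliceMatrix_gaugeTransform` and
  `Sketch.det_sliceMassHop_gaugeTransform`), unitarity of `Γ(G_g)`
  (`Sketch.fockGaugeAct_conjTranspose_mul_self`) and the Gauss law of `Ψ` give
  `Γ(G_g) χ(U') = χ(U'^g)` (`StubRayleighOfInvariant.fockGaugeAct_mulVec_weighted`), whence the
  pointwise identity `StubRayleighOfInvariant.integrand_eq_gaugeAverage`.
* Fubini in `(g, U')` (continuous integrand on the compact product, finite product measure),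
  the change of variables `U' ↦ U'^g` (`Sketch.CoreGaugeStep.integral_comp_gaugeTransform`: the
  product Haar measure `sliceHaar` is gauge invariant) and `∫ dg = 1` remove the Gauss average
  (`StubRayleighOfInvariant.integral_integral_gaugeAverage`), leaving exactly the integrand of
  `transferForm β mq Ψ Ψ`.

Pure theorem file (no definitions); helpers live in the sub-namespace `StubRayleighOfInvariant`.
The file-local notation `𝔾 = SU(3)` is the one of `QCDTransferMatrix.lean` and of the lead skeleton
(the registered signature is spelled with it); it shadows no library notation.

[cite: Luscher1977, pp. 283–292] [cite: Smit2023, §6.5 (6.87) and §4.6 (4.127)–(4.137)]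
-/

noncomputable section

namespace Summit.QuantumFields.QCD.Cruxes.StableActionBridge.TwistedTraceTransfer

local notation "𝔾" => Matrix.specialUnitaryGroup (Fin 3) ℂ

open MeasureTheory
open scoped InnerProductSpace ComplexConjugate Matrix BigOperators
open Literature.MathematicalPhysics.QuantumFieldTheory Literature.MathematicalPhysics.QuantumLattice
open Literature.Probability.LatticeModels (TorusSite)
open Summit.QuantumFields.QCD.Cruxes.StableActionBridge.Sketch

namespace StubRayleighOfInvariant

/-! ### Pointwise matrix algebra -/

/-- The double sum `Σ_s Σ_s' conj(x_s) M_{s s'} y_{s'}` is the sesquilinear pairing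
`⟨x, M y⟩ = star x ⬝ᵥ (M *ᵥ y)`. [folklore] -/
theorem sum_sum_eq_dotProduct {n : Type*} [Fintype n] (M : Matrix n n ℂ) (x y : n → ℂ) :
    ∑ s, ∑ s', (starRingEnd ℂ) (x s) * M s s' * y s' = star x ⬝ᵥ (M *ᵥ y) := by
  simp only [dotProduct, Matrix.mulVec, Pi.star_apply, starRingEnd_apply, Finset.mul_sum, mul_assoc]

/-- Moving a Hermitian factor across the pairing:
`⟨R_a v, (R_a B R_b)(R_b w)⟩ = ⟨R_a² v, B (R_b² w)⟩` for `R_aᴴ = R_a`. [folklore] -/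
theorem dotProduct_sandwich {n : Type*} [Fintype n] {Ra : Matrix n n ℂ} (hRa : Raᴴ = Ra)
    (B Rb : Matrix n n ℂ) (v w : n → ℂ) :
    star (Ra *ᵥ v) ⬝ᵥ ((Ra * B * Rb) *ᵥ (Rb *ᵥ w)) =
      star ((Ra * Ra) *ᵥ v) ⬝ᵥ (B *ᵥ ((Rb * Rb) *ᵥ w)) := by
  simp only [Matrix.star_mulVec, ← Matrix.dotProduct_mulVec, Matrix.mulVec_mulVec,
    Matrix.conjTranspose_mul, hRa, Matrix.mul_assoc]

/-- `Σ_s ‖(R v)_s‖² = ⟨v, R² v⟩` for a Hermitian matrix `R` (the real squared norm cast to `ℂ`).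
[folklore] -/
theorem sum_norm_sq_eq {n : Type*} [Fintype n] {Ra : Matrix n n ℂ} (hRa : Raᴴ = Ra) (v : n → ℂ) :
    ∑ s, ((‖(Ra *ᵥ v) s‖ ^ 2 : ℝ) : ℂ) = star v ⬝ᵥ ((Ra * Ra) *ᵥ v) := by
  have h : ∀ s, ((‖(Ra *ᵥ v) s‖ ^ 2 : ℝ) : ℂ) = (starRingEnd ℂ) ((Ra *ᵥ v) s) * (Ra *ᵥ v) s :=
    fun s => by rw [Complex.ofReal_pow, Complex.conj_mul']
  have h2 : ∑ s, (starRingEnd ℂ) ((Ra *ᵥ v) s) * (Ra *ᵥ v) s = star (Ra *ᵥ v) ⬝ᵥ (Ra *ᵥ v) := by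
    simp only [dotProduct, Pi.star_apply, starRingEnd_apply]
  simp_rw [h]
  rw [h2, Matrix.star_mulVec, ← Matrix.dotProduct_mulVec, Matrix.mulVec_mulVec, hRa]

/-! ### Finite sums through a matrix of integrals -/

/-- **Pairing with an entrywise-integral matrix**: if `M_{a c} = ∫ k(g) G(g)_{a c} dν(g)` with
integrable entries, then `⟨y, M x⟩ = ∫ k(g) ⟨y, G(g) x⟩ dν(g)` (finite sums commute with the
integral). [folklore] -/
theorem dotProduct_kernelMatrix_mulVec {A : Type*} [MeasurableSpace A] (ν : Measure A)
    {n : Type*} [Fintype n] (k : A → ℂ) (G : A → Matrix n n ℂ)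
    (hint : ∀ a c, Integrable (fun g => k g * G g a c) ν) (x y : n → ℂ) :
    star y ⬝ᵥ ((Matrix.of fun a c => ∫ g, k g * G g a c ∂ν) *ᵥ x) =
      ∫ g, k g * (star y ⬝ᵥ (G g *ᵥ x)) ∂ν := by
  have h1 : ∀ a c, star (y a) * ((∫ g, k g * G g a c ∂ν) * x c) =
      ∫ g, star (y a) * (k g * G g a c * x c) ∂ν := fun a c => by
    rw [← integral_mul_const, ← integral_const_mul]
  have h2 : ∀ a c, Integrable (fun g => star (y a) * (k g * G g a c * x c)) ν := fun a c =>
    ((hint a c).mul_const (x c)).const_mul (star (y a))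
  calc star y ⬝ᵥ ((Matrix.of fun a c => ∫ g, k g * G g a c ∂ν) *ᵥ x)
      = ∑ a, ∑ c, star (y a) * ((∫ g, k g * G g a c ∂ν) * x c) := by
        simp only [dotProduct, Matrix.mulVec, Matrix.of_apply, Pi.star_apply, Finset.mul_sum]
    _ = ∑ a, ∑ c, ∫ g, star (y a) * (k g * G g a c * x c) ∂ν := by simp_rw [h1]
    _ = ∑ a, ∫ g, ∑ c, star (y a) * (k g * G g a c * x c) ∂ν :=
        Finset.sum_congr rfl fun a _ => (integral_finsetSum _ fun c _ => h2 a c).symm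
    _ = ∫ g, ∑ a, ∑ c, star (y a) * (k g * G g a c * x c) ∂ν :=
        (integral_finsetSum _ fun a _ => integrable_finsetSum _ fun c _ => h2 a c).symm
    _ = ∫ g, k g * (star y ⬝ᵥ (G g *ᵥ x)) ∂ν := by
        refine integral_congr_ae (Filter.Eventually.of_forall fun g => ?_)
        simp only [dotProduct, Matrix.mulVec, Pi.star_apply, Finset.mul_sum]
        refine Finset.sum_congr rfl fun a _ => Finset.sum_congr rfl fun c _ => ?_
        ring

/-! ### Compactness and continuity bookkeeping -/

/-- A continuous complex function on a compact space is integrable for every finite measure.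
[folklore] -/
theorem integrable_of_continuous {X : Type*} [TopologicalSpace X] [CompactSpace X]
    [MeasurableSpace X] [OpensMeasurableSpace X] {μ : Measure X} [IsFiniteMeasure μ]
    {f : X → ℂ} (hf : Continuous f) : Integrable f μ :=
  hf.integrable_of_hasCompactSupport (HasCompactSupport.of_compactSpace f)

variable {Nf S : ℕ} [NeZero S]

omit [NeZero S] in
/-- Joint continuity of `(g, U) ↦ U^g` on the slice, in uncurried form
(`continuous_gaugeTransform_prod` of `WilsonTorusTransferMatrix`). [folklore] -/
theorem continuous_uncurry_gaugeTransform :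
    Continuous (Function.uncurry
      (gaugeTransform : (TorusSite 3 S → 𝔾) →
        GaugeConfig 3 S 𝔾 →
        GaugeConfig 3 S 𝔾)) :=
  continuous_gaugeTransform_prod (L := S) (G := 𝔾) (d := 3)

/-- Joint continuity of the Wilson gauge kernel `(U, U') ↦ K_β(U, U')`, in uncurried form
(`Sketch.continuous_gaugeSliceKernel`). [folklore] -/
theorem continuous_uncurry_gaugeSliceKernel (β : ℝ) :
    Continuous (Function.uncurry (gaugeSliceKernel (S := S) β)) :=
  continuous_gaugeSliceKernel S β

/-- Continuity of the complexified, gauge-averaged kernel integrand `g ↦ K_β(U, U'^g)`. [folklore] -/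
theorem continuous_gaugeSliceKernel_gaugeTransform (β : ℝ)
    (U U' : GaugeConfig 3 S 𝔾) :
    Continuous fun g : TorusSite 3 S → 𝔾 =>
      ((gaugeSliceKernel β U (gaugeTransform g U') : ℝ) : ℂ) :=
  Complex.continuous_ofReal.comp' (((continuous_uncurry_gaugeSliceKernel β).uncurry_left U).comp'
    (continuous_uncurry_gaugeTransform.uncurry_right U'))

/-- **The Fock-space gauge action `g ↦ Γ(G_g)` is continuous** in the time-independent gauge
transformation `g` (entries of `G_g = sliceGaugeRot g` are entries of the `g(x)` or `0`; `Γ` is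
continuous, `FermionSliceContinuous.continuous_fockLift`). [folklore] -/
theorem continuous_fockGaugeAct :
    Continuous fun g : TorusSite 3 S → 𝔾 =>
      fockGaugeAct (Nf := Nf) (S := S) g := by
  unfold fockGaugeAct sliceGaugeRot
  refine FermionSliceContinuous.continuous_fockLift (Continuous.matrix_reindex ?_ _ _)
  refine FermionSliceContinuous.continuous_sliceKron (continuous_matrix fun p q => ?_) 1
  have hentry : Continuous fun g : TorusSite 3 S → 𝔾 =>
      (g p.2.1 : Matrix (Fin 3) (Fin 3) ℂ) p.2.2 q.2.2 :=
    (continuous_apply p.2.1).subtype_val.matrix_elem p.2.2 q.2.2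
  simp only [Matrix.of_apply]
  exact hentry.if_const _ continuous_const

/-- The entries of the Gauss-averaged bond kernel have integrable integrands
`g ↦ K_β(U, U'^g) Γ(G_g)_{a c}` (continuous on the compact group of temporal links). [folklore] -/
theorem integrable_bondIntegrand (β : ℝ) (U U' : GaugeConfig 3 S 𝔾)
    (a c : Finset (SliceFermiIdx Nf S)) :
    Integrable (fun g : TorusSite 3 S → 𝔾 =>
      ((gaugeSliceKernel β U (gaugeTransform g U') : ℝ) : ℂ) * fockGaugeAct (Nf := Nf) g a c)
      (Measure.pi fun _ => haarProbability 𝔾) :=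
  integrable_of_continuous ((continuous_gaugeSliceKernel_gaugeTransform β U U').mul
    (continuous_fockGaugeAct.matrix_elem a c))

/-- **Removing the Gauss average**: for continuous `F` on the slice configurations,
`∫ dU' ∫ dg F(U'^g) = ∫ dU' F(U')` — Fubini (continuous integrand on the compact product, finite
product measure), the gauge invariance of the product Haar measure `sliceHaar`
(`CoreGaugeStep.integral_comp_gaugeTransform`) and `∫ dg = 1`. [folklore] -/
theorem integral_integral_gaugeAverage
    {F : GaugeConfig 3 S 𝔾 → ℂ} (hF : Continuous F) :
    ∫ U', ∫ g : TorusSite 3 S → 𝔾, F (gaugeTransform g U')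
        ∂(Measure.pi fun _ => haarProbability 𝔾) ∂(sliceHaar S) =
      ∫ U', F U' ∂(sliceHaar S) := by
  haveI := isProbabilityMeasure_sliceHaar S
  have hint : Integrable
      (Function.uncurry fun (g : TorusSite 3 S → 𝔾)
        (U' : GaugeConfig 3 S 𝔾) => F (gaugeTransform g U'))
      ((Measure.pi fun _ => haarProbability 𝔾).prod (sliceHaar S)) :=
    integrable_of_continuous (hF.comp continuous_uncurry_gaugeTransform)
  rw [← integral_integral_swap hint]
  have h2 : ∀ g : TorusSite 3 S → 𝔾,
      ∫ U', F (gaugeTransform g U') ∂(sliceHaar S) = ∫ U', F U' ∂(sliceHaar S) :=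
    fun g => CoreGaugeStep.integral_comp_gaugeTransform g hF
  simp_rw [h2]
  simp

/-- **Gauge covariance of the weighted wave `χ = T̂_F Ψ`**: for a gauge-invariant `Ψ`
(`Ψ(V^g) = Γ(G_g) Ψ(V)`), `Γ(G_g) (T̂_F(V) Ψ(V)) = T̂_F(V^g) Ψ(V^g)`, by
`T̂_F(V^g) = Γ(G_g) T̂_F(V) Γ(G_g)ᴴ` and unitarity of `Γ(G_g)`.
[cite: Smit2023, §4.6 (4.127) and §6.5 (6.91)] -/
theorem fockGaugeAct_mulVec_weighted (mq : Fin Nf → ℝ) {Ψ : SliceWave Nf S}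
    (hinv : IsGaugeInvariantWave Ψ) (g : TorusSite 3 S → 𝔾)
    (V : GaugeConfig 3 S 𝔾) :
    fockGaugeAct g *ᵥ (fermionSliceOp V mq *ᵥ Ψ V) =
      fermionSliceOp (gaugeTransform g V) mq *ᵥ Ψ (gaugeTransform g V) := by
  rw [fermionSliceOp_gaugeTransform_of Nf S g V mq (fermionSliceMatrix_gaugeTransform Nf S g V mq)
      (det_sliceMassHop_gaugeTransform Nf S g V mq), hinv g V, Matrix.mulVec_mulVec,
    Matrix.mulVec_mulVec, Matrix.mul_assoc (fockGaugeAct g * fermionSliceOp V mq),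
    (fockGaugeAct_conjTranspose_mul_self Nf S g).1, Matrix.mul_one]

/-- **The pointwise identity**: for a pointwise Hermitian square root `R` of `T̂_F` and a
gauge-invariant `Ψ`, the scalarised integrand
`Σ_s Σ_s' conj((RΨ)(U)_s) (R(U) B(U,U') R(U'))_{s s'} (RΨ)(U')_{s'}` is the Gauss average
`∫ K_β(U, U'^g) ⟨T̂_F(U)Ψ(U), T̂_F(U'^g)Ψ(U'^g)⟩ dg` of the integrand of Lüscher's transfer form.
[cite: Luscher1977, pp. 283–292] -/
theorem integrand_eq_gaugeAverage (β : ℝ) (mq : Fin Nf → ℝ)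
    {R : GaugeConfig 3 S 𝔾 →
      Matrix (Finset (SliceFermiIdx Nf S)) (Finset (SliceFermiIdx Nf S)) ℂ}
    (hR : ∀ U, (R U)ᴴ = R U ∧ R U * R U = fermionSliceOp U mq) {Ψ : SliceWave Nf S}
    (hinv : IsGaugeInvariantWave Ψ) (U U' : GaugeConfig 3 S 𝔾) :
    (∑ s, ∑ s', (starRingEnd ℂ) ((R U *ᵥ Ψ U) s) *
      ((R U * (Matrix.of fun a c => ∫ g : TorusSite 3 S → 𝔾,
          (gaugeSliceKernel β U (gaugeTransform g U') : ℂ) * fockGaugeAct (Nf := Nf) g a c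
            ∂(Measure.pi fun _ => haarProbability 𝔾)) * R U') s s') *
        (R U' *ᵥ Ψ U') s') =
    ∫ g : TorusSite 3 S → 𝔾,
      ((gaugeSliceKernel β U (gaugeTransform g U') : ℝ) : ℂ) *
        (star (fermionSliceOp U mq *ᵥ Ψ U) ⬝ᵥ
          (fermionSliceOp (gaugeTransform g U') mq *ᵥ Ψ (gaugeTransform g U')))
      ∂(Measure.pi fun _ => haarProbability 𝔾) := by
  have hcov : ∀ g : TorusSite 3 S → 𝔾,
      fockGaugeAct g *ᵥ (fermionSliceOp U' mq *ᵥ Ψ U') =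
        fermionSliceOp (gaugeTransform g U') mq *ᵥ Ψ (gaugeTransform g U') :=
    fun g => fockGaugeAct_mulVec_weighted mq hinv g U'
  rw [sum_sum_eq_dotProduct, dotProduct_sandwich (hR U).1, (hR U).2, (hR U').2,
    dotProduct_kernelMatrix_mulVec
      (Measure.pi fun _ => haarProbability 𝔾)
      (fun g => ((gaugeSliceKernel β U (gaugeTransform g U') : ℝ) : ℂ))
      (fun g => fockGaugeAct (Nf := Nf) (S := S) g) (integrable_bondIntegrand β U U')]
  simp_rw [hcov]

end StubRayleighOfInvariant

open StubRayleighOfInvariant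

/-- **Sub-goal B4 of step E3 (registered stub `stub_rayleigh_of_invariant`): on gauge-invariant waves
the scalarised transfer form IS Lüscher's transfer form.**  For ANY continuous pointwise Hermitian
square root `R` of `T̂_F` (`R(U)ᴴ = R(U)`, `R(U)² = T̂_F(U) = fermionSliceOp U mq`) and every continuous
gauge-invariant wave function `Ψ ∈ transferCore` (`Ψ(U^g) = Γ(G_g) Ψ(U)`), the quadratic form of the
Hermitian kernel `R(U) B(U,U') R(U')`, `B(U,U') = ∫ K_β(U, U'^g) Γ(G_g) dg`, at the vector
`U ↦ R(U) Ψ(U)` equals `transferForm β mq Ψ Ψ`, and `∫ Σ_s ‖(R(U)Ψ(U))_s‖² dU = fermionWeightForm mq Ψ Ψ`: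
`⟨RΨ(U), R B R Ψ(U')⟩ = ⟨T̂_FΨ(U), B(U,U') T̂_FΨ(U')⟩`, `Γ(G_g) T̂_F(U')Ψ(U') = (T̂_FΨ)(U'^g)`
(covariance `Sketch.fermionSliceOp_gaugeTransform_of` + Gauss law of `Ψ`), then `U' ↦ U'^g` preserves
the product Haar measure and the `g`-average of a constant is the constant.
[cite: Luscher1977, pp. 283–292] [cite: Smit2023, §6.5 (6.87)] -/
theorem stub_rayleigh_of_invariant : ∀ (Nf S : ℕ) [NeZero S] (β : ℝ) (mq : Fin Nf → ℝ), (∀ f, -1 < mq f) →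
    ∀ R : GaugeConfig 3 S 𝔾 → Matrix (Finset (SliceFermiIdx Nf S)) (Finset (SliceFermiIdx Nf S)) ℂ,
    Continuous R → (∀ U, (R U)ᴴ = R U ∧ R U * R U = fermionSliceOp U mq) →
    ∀ Ψ : SliceWave Nf S, Ψ ∈ transferCore Nf S →
      (∫ U, ∫ U', ∑ s, ∑ s', (starRingEnd ℂ) ((R U *ᵥ Ψ U) s) *
          ((R U * (Matrix.of fun a c => ∫ g : TorusSite 3 S → 𝔾,
              (gaugeSliceKernel β U (gaugeTransform g U') : ℂ) * fockGaugeAct (Nf := Nf) g a c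
                ∂(Measure.pi fun _ => haarProbability 𝔾)) * R U') s s') * (R U' *ᵥ Ψ U') s'
          ∂(sliceHaar S) ∂(sliceHaar S) = transferForm β mq Ψ Ψ) ∧
      (∫ U, ∑ s, ((‖(R U *ᵥ Ψ U) s‖ ^ 2 : ℝ) : ℂ) ∂(sliceHaar S) = fermionWeightForm mq Ψ Ψ) := by
  intro Nf S _ β mq hm R _hRc hR Ψ hΨ
  obtain ⟨hΨc, hinv⟩ := hΨ
  refine ⟨?_, ?_⟩
  · -- the weighted wave `χ = T̂_F Ψ` is continuous
    have hχ : Continuous fun V : GaugeConfig 3 S 𝔾 =>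
        fermionSliceOp V mq *ᵥ Ψ V :=
      (continuous_fermionSliceOp Nf S mq hm).matrix_mulVec hΨc
    -- the integrand of `transferForm`, as a function of the second slice, is continuous
    have hF : ∀ U : GaugeConfig 3 S 𝔾,
        Continuous fun V : GaugeConfig 3 S 𝔾 =>
          ((gaugeSliceKernel β U V : ℝ) : ℂ) *
            (star (fermionSliceOp U mq *ᵥ Ψ U) ⬝ᵥ (fermionSliceOp V mq *ᵥ Ψ V)) := fun U =>
      (Complex.continuous_ofReal.comp' ((continuous_uncurry_gaugeSliceKernel β).uncurry_left U)).mul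
        (continuous_const.dotProduct hχ)
    -- assemble: pointwise identity, then remove the Gauss average slice by slice
    unfold transferForm
    exact integral_congr_ae (Filter.Eventually.of_forall fun U =>
      (integral_congr_ae (Filter.Eventually.of_forall
        (integrand_eq_gaugeAverage β mq hR hinv U))).trans (integral_integral_gaugeAverage (hF U)))
  · have h2 : ∀ U : GaugeConfig 3 S 𝔾,
        (∑ s, ((‖(R U *ᵥ Ψ U) s‖ ^ 2 : ℝ) : ℂ)) = star (Ψ U) ⬝ᵥ (fermionSliceOp U mq *ᵥ Ψ U) :=
      fun U => by rw [sum_norm_sq_eq (hR U).1, (hR U).2]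
    unfold fermionWeightForm
    exact integral_congr_ae (Filter.Eventually.of_forall h2)

end Summit.QuantumFields.QCD.Cruxes.StableActionBridge.TwistedTraceTransfer

end
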